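import Summits.RiemannHypothesis.RiemannHypothesis.Theorems.WeilColumnBSplineCDF
import HarnessLib

/-!
# THETA kernel certificate: the CUT `χ = P.cut` and D1 without hypotheses, in the interface's names (`ThetaParams`, p418783) (RH-FREE)

Cell `rh-explicit`, WEIL column, seat handoff-prove-2 gen12 (THETA-ASSIGN v1.0 §3: the cut half of W3, from W1 `WeilColumnBSplineCDF`).
`χ ∈ [0,1]`, monotone, `χ = 0` on `(−∞, −a]`, `χ = 1` on `[x₁, ∞)` (`x₁ = η − a`), `HasDerivAt χ (re ρ(x + a − η/2)) x` with
`|χ′| ≤ m/η` (`m ≥ 2`); and for an admissible row: `x₁ < 0`, the profile is continuous (W0), hence D1 `‖Θ(u)‖ ≤ M·(u/u₁)^m` with NO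
continuity hypothesis (`norm_Θ_le'`).  Nothing here bears on the truth of RH.
-/

noncomputable section

set_option linter.dupNamespace false

open Complex Set MeasureTheory Filter
open scoped Real Topology

namespace Summit.RiemannHypothesis.RiemannHypothesis.Theorems.WeilColumn.ThetaMellin

open Literature.NumberTheory.LFunctions

namespace ThetaParams

variable (P : ThetaParams)

/-! ## §1 The cut `χ = P.cut` -/

/-- the cut's B-spline scale `c = η/(2m)` is positive for `η > 0`, `m ≥ 1`. -/
theorem cut_scale_pos (hη : 0 < P.η) (hm : 1 ≤ P.m) : 0 < P.η / (2 * P.m) := by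
  have : (0 : ℝ) < P.m := Nat.cast_pos.2 (by omega)
  positivity

/-- `χ x ∈ [0, 1]`. -/
theorem cut_mem_Icc (hη : 0 < P.η) (hm : 1 ≤ P.m) (x : ℝ) : P.cut x ∈ Icc (0 : ℝ) 1 :=
  ⟨bsplineCDF_nonneg (P.cut_scale_pos hη hm).le _ _, bsplineCDF_le_one (P.cut_scale_pos hη hm) _ _⟩

/-- `χ x = 1` for `x ≥ x₁ = η − a`. -/
theorem cut_eq_one (hη : 0 < P.η) (hm : 1 ≤ P.m) {x : ℝ} (hx : P.x₁ ≤ x) : P.cut x = 1 := by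
  unfold cut
  refine bsplineCDF_eq_one (P.cut_scale_pos hη hm) _ ?_
  have hm0 : (0 : ℝ) < P.m := Nat.cast_pos.2 (by omega)
  have e : (((P.m - 1 : ℕ) : ℝ) + 1) * (P.η / (2 * P.m)) = P.η / 2 := by
    rw [Nat.cast_sub hm]; push_cast; field_simp; ring
  rw [e]; unfold x₁ at hx; linarith

/-- `χ x = 0` for `x ≤ −a`. -/
theorem cut_eq_zero (hη : 0 < P.η) (hm : 1 ≤ P.m) {x : ℝ} (hx : x ≤ -P.a) : P.cut x = 0 := by
  unfold cut
  refine bsplineCDF_eq_zero (P.cut_scale_pos hη hm).le _ ?_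
  have hm0 : (0 : ℝ) < P.m := Nat.cast_pos.2 (by omega)
  have e : (((P.m - 1 : ℕ) : ℝ) + 1) * (P.η / (2 * P.m)) = P.η / 2 := by
    rw [Nat.cast_sub hm]; push_cast; field_simp; ring
  rw [e]; linarith

/-- `χ` is monotone. -/
theorem cut_mono (hη : 0 < P.η) (hm : 1 ≤ P.m) : Monotone P.cut := fun x y hxy ↦
  bsplineCDF_mono (P.cut_scale_pos hη hm).le _ (by linarith)

/-- `χ′(x) = re ρ(x + a − η/2)`, `ρ = bsplineDensity (η/(2m)) (m−1)` (`m ≥ 2`). -/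
theorem hasDerivAt_cut (hη : 0 < P.η) (hm : 2 ≤ P.m) (x : ℝ) :
    HasDerivAt P.cut ((bsplineDensity (P.η / (2 * P.m)) (P.m - 1) (x + P.a - P.η / 2)).re) x := by
  have h := hasDerivAt_bsplineCDF (P.cut_scale_pos hη (by omega)) (k := P.m - 1) (by omega) (x + P.a - P.η / 2)
  have hlin : HasDerivAt (fun x : ℝ ↦ x + P.a - P.η / 2) 1 x := by
    simpa using ((hasDerivAt_id x).add_const P.a).sub_const (P.η / 2)
  have := h.comp x hlin
  have e : P.cut = fun x ↦ bsplineCDF (P.η / (2 * P.m)) (P.m - 1) (x + P.a - P.η / 2) := rfl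
  rw [e]
  simpa [Function.comp_def] using this

/-- `|χ′| ≤ m/η` (`m ≥ 2`). -/
theorem abs_cut_deriv_le (hη : 0 < P.η) (hm : 2 ≤ P.m) (x : ℝ) :
    |(bsplineDensity (P.η / (2 * P.m)) (P.m - 1) (x + P.a - P.η / 2)).re| ≤ P.m / P.η := by
  have hc := P.cut_scale_pos hη (by omega)
  rw [abs_of_nonneg (bsplineDensity_re_nonneg hc.le _ _)]
  refine (bsplineDensity_re_le hc _ _).trans (le_of_eq ?_)
  have hm0 : (0 : ℝ) < P.m := Nat.cast_pos.2 (by omega)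
  field_simp

/-! ## §2 Admissible rows: `x₁ < 0`, continuity of the profile, D1 hypothesis-free -/

/-- `x₁ < 0` and `u₁ = e^{x₁}` for an admissible row. -/
theorem x₁_neg {qn : ℕ} (hP : P.Admissible qn) : P.x₁ < 0 := by
  have := hP.eta_lt; unfold x₁; linarith

/-- The profile is continuous for an admissible row (`m ≥ 3 ≥ 2`, `ε > 0`) — W0. -/
theorem continuous_h {qn : ℕ} (hP : P.Admissible qn) : Continuous P.h := by
  have hε : 0 < P.ε := by have := hP.delta_pos; have := hP.c₂_pos; unfold ε; positivity
  exact continuous_profile_of_two_le (le_trans (by norm_num) hP.three_le) hε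

/-- D1 without the continuity hypothesis: `‖Θ(u)‖ ≤ M·(u/u₁)^m` for `u > 0`. -/
theorem norm_Θ_le' {qn : ℕ} (hP : P.Admissible qn) {u : ℝ} (hu : 0 < u) : ‖P.Θ u‖ ≤ P.M * (u / P.u₁) ^ P.m :=
  P.norm_Θ_le hP (P.continuous_h hP) hu

end ThetaParams

end Summit.RiemannHypothesis.RiemannHypothesis.Theorems.WeilColumn.ThetaMellin

end
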